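import Summits.CriticalPhenomena.PercolationContinuityZ3.Theorems.Transplant.Slab111VSwapPlan
import Summits.CriticalPhenomena.PercolationContinuityZ3.Theorems.Transplant.Slab111VCover
import Summits.CriticalPhenomena.PercolationContinuityZ3.Theorems.Transplant.Slab111VNeed
import HarnessLib

/-!
# The routing certificate for `ShapedLinkage 3 (Slab111.hexShadow k)`, VII: the node at a block of a certified type

builds on p205010 (kernel theorem, internal audit signed; external expert review pending) — NOT used in this file.  Lane `prim-bschramm`, seat
`prim-bschramm-p2` (gen 35; class C1b; memo `HOME/bschramm/P2-LATTICES.md` §129); helper file (`--supports stmt-CriticalPhenomena-4575 --as helper`).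
ASSEMBLY for one block `(z, t_R, t_D, s_R, s_D)` of the `(111)`-film `F_k`, `k ≥ 10`: if the Boolean certificate `Srch.certAllB` of the block's reduced
type `rkey t_R t_D s_R s_D` («Slab111VBundle») evaluates to `true`, the conclusion of the node «HexShadowVRouteData».`ShapedLinkage 3` holds at that block
with the cleared set `W := Wset` of the reduced type («Slab111VShapes»): the containments are those of «Slab111VShapes»; given certified terminals,
«Slab111VNeed» lists their configuration and status item, «Slab111VCover» extracts a checked fitting plan (two stack plans when `E₁, E₂` share a
column), and «Slab111VSwapPlan» turns it into the swap pair.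
* §1 reduced blocks: `blkR_cap`, `blkR_mono`;
* §2 **`linkage_of_certAllB`**.
[cite: DuminilCopinSidoraviciusTassion2016, §2.3 (proof of Fact 2: the three disjoint paths γ_u, γ_v, γ_w in B_R(z))]
-/

noncomputable section

namespace Summit.CriticalPhenomena.PercolationContinuityZ3.Theorems.Transplant

open Literature.Probability.Percolation Literature.Probability.LatticeModels SimpleGraph
open scoped Classical

namespace Slab111

variable {k : ℕ}

/-! ## §1 Reduced blocks -/

/-- Inside the radius-`3` hexagon the clip parameters may be capped at `3`. [folklore] -/
theorem blkR_cap (z : Site 2) (t s : ℕ) : blkR 3 z t s = blkR 3 z (cap3 t) (cap3 s) := by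
  ext w
  simp only [mem_blkR, mem_hexBall, triNorm, Pi.sub_apply, max_le_iff, abs_le, cap3, Nat.cast_min, Nat.cast_ofNat]
  constructor
  · rintro ⟨h1, h2, h3⟩; exact ⟨h1, by omega, by omega⟩
  · rintro ⟨h1, h2, h3⟩; exact ⟨h1, by omega, by omega⟩

/-- Clipped blocks grow with the clip parameters. [folklore] -/
theorem blkR_mono (z : Site 2) {t t' s s' : ℕ} (ht : t ≤ t') (hs : s ≤ s') : blkR 3 z t s ⊆ blkR 3 z t' s' := by
  intro w hw
  simp only [mem_blkR] at hw ⊢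
  exact ⟨hw.1, by omega, by omega⟩

/-- A point of the unit hexagon inside `blkR 3 z t_D s_D` lies in the reduced cleared block. [folklore] -/
theorem mem_blkR_rkey_of_hexBall_one {z w : Site 2} {tR tD sR sD : ℕ} (h1 : w ∈ hexBall z 1) (hD : w ∈ blkR 3 z tD sD) :
    w ∈ blkR 3 z (rkey tR tD sR sD).tD (rkey tR tD sR sD).sD := by
  rw [mem_hexBall] at h1
  simp only [triNorm, Pi.sub_apply, max_le_iff, abs_le] at h1
  simp only [mem_blkR, rkey, cap3, Nat.cast_min, Nat.cast_ofNat, Nat.cast_add, Nat.cast_one] at hD ⊢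
  exact ⟨hD.1, by omega, by omega⟩

/-! ## §2 The node at a certified block -/

/-- **The node's conclusion at one block of a certified reduced type.**  For `k ≥ 10` and a block `(z, t_R, t_D, s_R, s_D)` whose reduced type passes
the certificate, the cleared set `Wset` of the reduced type satisfies the two containments and admits a swap pair of routings for every certified
terminal triple. [cite: DuminilCopinSidoraviciusTassion2016, §2.3 (proof of Fact 2)] -/
theorem linkage_of_certAllB (hk : 10 ≤ k) (z : Site 2) {tR tD sR sD : ℕ} (hcert : Srch.certAllB (rkey tR tD sR sD) = true) :
    ∃ W : Set (slab111 k), (∀ x ∈ W, (hexShadow k).sh x ∈ blkR 3 z tD sD) ∧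
      (∀ x, (hexShadow k).sh x ∈ hexBall z 1 → (hexShadow k).sh x ∈ blkR 3 z tD sD → x ∈ W) ∧
      ∀ (E₁ E₂ w' : slab111 k), (hexShadow k).Terminals 3 z tR tD sR W E₁ E₂ w' →
        ∃ r₁ r₂ : VRouteData (film k) (W ∩ (hexShadow k).lift (blkR 3 z tR sR)) W E₁ E₂ w', r₁.y = r₂.b ∧ r₁.b = r₂.y := by
  set K := rkey tR tD sR sD with hK
  have hKt : K.tD ≤ tD := by simp only [hK, rkey, cap3]; omega
  have hKs : K.sD ≤ sD := by simp only [hK, rkey, cap3]; omega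
  have hR : blkR 3 z tR sR = blkR 3 z K.tR K.sR := by rw [blkR_cap]; rfl
  refine ⟨Wset k z K.tR K.tD K.sR K.sD, fun x hx => blkR_mono z hKt hKs (Wset_subset_blk k z _ _ _ _ x hx),
    fun x h1 hD => mem_Wset_of_hexBall_one k z _ _ _ _ x h1 (mem_blkR_rkey_of_hexBall_one (tR := tR) (sR := sR) h1 hD), ?_⟩
  intro E₁ E₂ w' hT
  have hKk : KMAX ≤ (k : ℤ) := by unfold KMAX; exact_mod_cast hk
  obtain ⟨⟨hc1, hc2, hc3, hx⟩, hit⟩ := cfg_item_of_terminals hk hT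
  have hc := Srch.certOK_of_certAllB hcert hc1 hc2 hc3 hx
  have hS := sctx_mem_sctxs K z k
  -- the searched context of `z, k` carries the fast form of `Ctx.of K (cls z) (k % 3)` (definitionally)
  have chk : ∀ {P : PlanD}, P.checkT (Srch.SCtx.of (Ctx.of K (cls z) (k % 3))).T = true → P.check (Ctx.of K (cls z) (k % 3)) = true :=
    fun h => PlanD.check_of_checkT _ _ h
  have alw : ∀ {P : PlanD} {s1 s2 s3 : ℕ}, P.allowsT (Srch.SCtx.of (Ctx.of K (cls z) (k % 3))).T s1 s2 s3 = true →
      P.allows (Ctx.of K (cls z) (k % 3)) s1 s2 s3 = true := fun h => by rw [← PlanD.allowsT_eq]; exact h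
  have hE₁ : E₁ ∈ Wset k z K.tR K.tD K.sR K.sD ∩ (hexShadow k).lift (blkR 3 z K.tR K.sR) := ⟨hT.E₁W, by rw [HexShadow.mem_lift, ← hR]; exact hT.E₁R⟩
  have hE₂ : E₂ ∈ Wset k z K.tR K.tD K.sR K.sD ∩ (hexShadow k).lift (blkR 3 z K.tR K.sR) := ⟨hT.E₂W, by rw [HexShadow.mem_lift, ← hR]; exact hT.E₂R⟩
  rw [hR]
  by_cases hst : Srch.isStackItem (rcol z E₁) (rcol z E₂)
      (statusOf k (lev (E₁ : Site 3)), statusOf k (lev (E₂ : Site 3)), statusOf k (lev (w' : Site 3))) = true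
  · -- E₁, E₂ over one column, both at middle levels: stack plans, oriented by the levels
    obtain ⟨hc12, -, -⟩ := Srch.isStackItem_iff.1 hst
    have hlev : lev (E₁ : Site 3) ≠ lev (E₂ : Site 3) := fun e =>
      hT.ne (eq_of_sh_eq_of_lev_eq (by rw [sh_eq_vcol_rcol z E₁, sh_eq_vcol_rcol z E₂, hc12]) e)
    rcases lt_or_gt_of_ne hlev with hlt | hgt
    · obtain ⟨P, hP, hf, hkm, ⟨lam0, hkind⟩, hal⟩ := Srch.stackPlans_of_certOK hc hS hit hst true
      exact swap_of_plan hKk (chk hP) hkm hf hT.ne hE₁ hE₂ hT.w'W (sh_eq_vcol_rcol z E₁) (sh_eq_vcol_rcol z E₂) (sh_eq_vcol_rcol z w') (alw hal)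
        (fun lam0' low h => by rw [hkind] at h; cases h; exact ⟨hc12, by simpa using hlt⟩)
    · obtain ⟨P, hP, hf, hkm, ⟨lam0, hkind⟩, hal⟩ := Srch.stackPlans_of_certOK hc hS hit hst false
      exact swap_of_plan hKk (chk hP) hkm hf hT.ne hE₁ hE₂ hT.w'W (sh_eq_vcol_rcol z E₁) (sh_eq_vcol_rcol z E₂) (sh_eq_vcol_rcol z w') (alw hal)
        (fun lam0' low h => by rw [hkind] at h; cases h; exact ⟨hc12, by simpa using hgt⟩)
  · obtain ⟨P, hP, hf, hkm, hns, hal⟩ := Srch.plan_of_certOK hc hS hit (by simpa using hst)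
    exact swap_of_plan hKk (chk hP) hkm hf hT.ne hE₁ hE₂ hT.w'W (sh_eq_vcol_rcol z E₁) (sh_eq_vcol_rcol z E₂) (sh_eq_vcol_rcol z w') (alw hal)
      (fun lam0 low h => absurd h (hns lam0 low))

end Slab111

end Summit.CriticalPhenomena.PercolationContinuityZ3.Theorems.Transplant
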